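import Literature.Probability.RandomPlanarGeometry.SAWTriangularPolygonUnrooting
import Literature.Probability.RandomPlanarGeometry.SAWTriangularPolygonClasses
import HarnessLib

/-!
# The two tree normalisations of `q_N(𝕋)` agree: canonical traversals = edge-set classes up to translation

Topic `Literature/Probability/RandomPlanarGeometry` (lane «pcv-sawmu», a-p4 g9; a bridge between two independently landed
editions of Madras–Slade (3.2.1) on the triangular lattice:
`SAWTriangularPolygonClasses.lean` (door «TRI-POLYGON-AS-PRINTED»: `triPolygonCount N` = the number of translation classes
`triPolygonClasses N` of the edge sets of the `N`-gons of `𝕋`, `triLoopCount_eq_two_mul_mul_triPolygonCount : triLoopCount N =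
2N · triPolygonCount N`) and `SAWTriangularPolygonUnrooting.lean` (`triPolygonNumber N` = the number of canonical traversals
`TriPolygon.triPolygonReps (N−1)`, `triLoopCount_eq_mul_triPolygonNumber : triLoopCount N = 2N · triPolygonNumber N`)).

Source: N. Madras, G. Slade, *The Self-Avoiding Walk* (1993), §3.2, Definition 3.2.2 and eq. (3.2.1) p. 63 (`q_N` := the number of
`N`-step self-avoiding polygons up to translation; printed: "(3.2.1) `2N q_N = 2d c_{N−1}(0,e)` for every `N > 2`", `e` a nearest neighbour of
`0`; summed over the neighbours this is the form `Σ_y c_{N−1}(0,y) = 2N q_N` that the tree's `triLoopCount` uses on `𝕋`).  Both tree numbers satisfy (3.2.1) with the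
same left-hand side `triLoopCount N`, so they are equal for `N ≥ 3`; the consequences proved for `triPolygonNumber` in
`SAWTriangularPolygonSupermult.lean` / `SAWTriangularPolygonUnrooting.lean` therefore hold verbatim for `triPolygonCount`.

## What is proved (namespace `…SAW`; all `theorem`s, axioms standard)

* **`triPolygonNumber_eq_triPolygonCount (hN : 3 ≤ N) : triPolygonNumber N = triPolygonCount N`**;
* `triPolygonCount_mul_le (hN : 3 ≤ N) (hM : 3 ≤ M) : q_N · q_M ≤ 2 · q_{N+M}` and `triPolygonCount_le_succ (hN : 3 ≤ N) : q_N ≤ q_{N+1}`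
  in the edge-set normalisation (Madras–Slade Theorem 3.2.3, (3.2.2) with `d − 1 ↦ 2` and (3.2.3) with shift `1`, transported).
-/

noncomputable section

namespace Literature.Probability.RandomPlanarGeometry.SAW

/-- **The two normalisations of `q_N(𝕋)` agree** (`N ≥ 3`): the number of canonical traversals equals the number of translation
classes of edge sets, since both satisfy (3.2.1) `triLoopCount N = 2N · q_N`.
[cite: MadrasSlade1993, §3.2, Definition 3.2.2 and eq. (3.2.1) p. 63] -/
theorem triPolygonNumber_eq_triPolygonCount {N : ℕ} (hN : 3 ≤ N) : triPolygonNumber N = triPolygonCount N := by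
  have h : 2 * N * triPolygonNumber N = 2 * N * triPolygonCount N :=
    (triLoopCount_eq_mul_triPolygonNumber hN).symm.trans (triLoopCount_eq_two_mul_mul_triPolygonCount hN)
  exact Nat.eq_of_mul_eq_mul_left (by omega) h

/-- **Madras–Slade (3.2.2) on `𝕋` (with `d − 1` replaced by `2`), edge-set normalisation**: `q_N · q_M ≤ 2 · q_{N+M}` for `N, M ≥ 3`.
[cite: MadrasSlade1993, Theorem 3.2.3 (3.2.2) and (3.2.4), pp. 64–65 (ℤ^d; triangular edition with d−1 ↦ 2)] -/
theorem triPolygonCount_mul_le {N M : ℕ} (hN : 3 ≤ N) (hM : 3 ≤ M) :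
    triPolygonCount N * triPolygonCount M ≤ 2 * triPolygonCount (N + M) := by
  rw [← triPolygonNumber_eq_triPolygonCount hN, ← triPolygonNumber_eq_triPolygonCount hM,
    ← triPolygonNumber_eq_triPolygonCount (by omega)]
  exact triPolygonNumber_mul_le (by omega) hM

/-- **Madras–Slade (3.2.3) on `𝕋` with the natural shift `+1`, edge-set normalisation**: `q_N ≤ q_{N+1}` for `N ≥ 3`.
[cite: MadrasSlade1993, Theorem 3.2.3, eq. (3.2.3) p. 64 (ℤ^d, shift 2; triangular edition)] -/
theorem triPolygonCount_le_succ {N : ℕ} (hN : 3 ≤ N) : triPolygonCount N ≤ triPolygonCount (N + 1) := by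
  rw [← triPolygonNumber_eq_triPolygonCount hN, ← triPolygonNumber_eq_triPolygonCount (by omega)]
  exact triPolygonNumber_le_succ N

end Literature.Probability.RandomPlanarGeometry.SAW

end
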